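import Summits.QuantumFields.YangMills.Theorems.BalabanUVNodesN13U1PieceToPieceStepAtRecord13CoPH

/-!
# BalabanUVNodes ∕ N13 — THE (0.2) PIECE TOWER AT NODE 00's STAGE-13 RECORD: [IV] (0.4) BY INDUCTION ON THE LEVEL, IN KERNEL FORM — per-last-region majorants propagated by the
# piece-to-piece step (Track A, DAG node N13 = [B16]; cluster K1 — K1⁷ `StabilityBAtRecordR13SepCoPH` = stmt-QuantumFields-20542, helper; seat `pub-ymgap-dag-n13-w6` g2, own-stem
# successor of `…N13U1PieceToPieceStepAtRecord13CoPH` (p611473) and `…N13U1StepPieceCountAtRecord13CoPH` (p610171); 2026-08-28; count-neutral)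

HONEST FRAMING.  Count-neutral kernel BOOKKEEPING + [folklore] measure theory; nothing of Bałaban's is asserted.  p611473 proved THE (0.2) PIECE-TO-PIECE STEP: the level-(k+1) piece of
the density of record is bounded by the transported level-`k` pieces summed over last regions, `|ρ_{k+1}(Z′,V′)| ≤ Σ_Z Σ_{q after Zᶜ, Λ_{k+1}(q)ᶜ = Z′} X(q)·C(Z,q)·T_k(W(Z,q)·ρ_k(Z,·))(V′)`,
under displayed rows.  THIS FILE ITERATES IT — the last-region-currency twin of dag-n13-w3's history tower `abs_histTerm_le_of_majorantTower` (S1): a family of field-dependent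
PER-LAST-REGION majorants `m_j(Z)(U)` (measurable, bounded) with the BASE `ρ_0(Z,·) ≤ m_0(Z)` and the STEP ROWS «`Σ_Z Σ_{q after Zᶜ, Λ_{j+1}(q)ᶜ = Z′} X_j(q)(V′)·C_j(Z,q)(V′)·
T_j(W_j(Z,q)(·,V′)·m_j(Z))(V′) ≤ m_{j+1}(Z′)(V′)`» (`j < k`) bounds EVERY level-`k` piece, `ρ_k(Z,V) ≤ m_k(Z)(V)` (★★★ `pieceOfRecord_le_of_pieceTower`): at each level the old pieces are
replaced by their majorants UNDER the transport by monotonicity (`transportOfRecord_mono`), so the level-`j` input of the step row is ONE function per last region `Z`, averaged by `T_j` —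
[IV] (0.2)–(0.4)'s induction shape *«ρ(V) = Σ_Z ρ(Z,V) … |ρ(Z,V)| ≤ …»*.  THE BASE IS PROVED up to the letter: at level 0 the only last region is `∅ᶜ` and the piece is the start
`ρ₀ = e^{−E}·(Wilson–Boltzmann weight) ≤ e^{−E}` (`pieceOfRecord_zero_eq` ∕ `pieceOfRecord_zero_le`; n22-b `Seq.sum_seq_zero`, def-T `chiSeqOfRecord_zero` ∕ `texpAOfRecord_zero` ∕
`rhoZeroOfRecord_le`).  The ROWS (displayed unless said otherwise), for every level `j < k`: (r1) history terms `≥ 0` — DISCHARGED at the record by dag-n13-w1's `histTerm_nonneg`; (r2) they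
are measurable; (r3) `|w_j(s.snoc e)| ≤ W_j(Λ_j(s)ᶜ,e)` with `0 ≤ W_j ≤ 1` measurable (def-T-side structure row, `W := 1` inhabits it); (r4) `χ_{j+1}(s.snoc e) ≤ X_j(e)`, `X_j ≥ 0` (sharp
by p611473's `chiSeqOfRecord_snoc_eq_of_fst_eq`); (r5) the 𝐑-ratio rows with `0 ≤ c_R ≤ C_j(Λ_j(s)ᶜ,e)`, `C_j ≥ 0` ([IV] (0.3); `C := 1` at live selectors); the majorants' measurability ∕
boundedness; the base; the step rows.  WHERE PRINT's K-UNIFORMITY LIVES (LOCATED, not here): in meeting the step rows with `m_j` kept UNDER the averaging `T_j` (normalisation of the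
renormalization transformation), not in sup currency — dag-n13-w3's located remark (INTENT-4 `…N13U1SupRoadMarginalDensity…`: the pure sup road is NOT K-uniform).  (U1) NOT proved;
[III] Cor. 3 NOT proved; N13 NOT discharged; K0⁷ ∕ K1⁷ NOT closed; counts unmoved (discharged 5∕27 · Track A 5∕28).  ONE finite four-torus programme at fixed `ε = L^{−K}`; R4 closes the
conditional finite-𝕋⁴ rung `BalabanLadder.UV` only — the Yang–Mills mass gap (Clay) is NOT proved by any of this; nothing continuum ∕ ℝ⁴ ∕ OS.  No `sorry`, `def`, `instance`, `notation`.

WHAT THIS FILE PROVES.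
§1 generic over the represented tower of record (S1 §2's letters): `transportOfRecord_mono` [folklore], `pieceOfRecord_nonneg`, `histTerm_zero_eq`, ★ `pieceOfRecord_zero_eq` ∕ `pieceOfRecord_zero_le`
   (THE BASE), ★★★ `pieceOfRecord_le_of_pieceTower` (THE TOWER).
§2 at K1⁷'s record: `pieceOfRecord₁₃_zero_le`, ★★★ `pieceOfRecord₁₃_le_of_pieceTower` ((r1) discharged; the rest displayed).

Sources: [Balaban1989LargeFieldI] (0.2)–(0.4) p.176, p.175; [Balaban1988Convergent] (2.18) p.257, Thm 1 p.262, (2.49) p.264, (3.1) p.264, §3 p.267, (3.24)–(3.25) p.270;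
[Balaban1989LargeFieldII] (1.89) p.387.
-/

noncomputable section

open MeasureTheory
open scoped BigOperators

namespace Summit.QuantumFields.YangMills.BalabanUVNodes.N13U1PieceTowerAtRecord13CoPH

open Literature.MathematicalPhysics.QuantumFieldTheory.Balaban1983to89
open T4Continuum Node00 B14.Eq218Concrete
open Summit.QuantumFields.YangMills.BalabanUVNodes.N13U1StepMajorantTowerAtRecord13CoPH (abs_transportOfRecord_le)
open Summit.QuantumFields.YangMills.BalabanUVNodes.N13U1PieceToPieceStepAtRecord13CoPH (abs_pieceOfRecord_succ_le_sum_lastRegion_transport_piece)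
open Summit.QuantumFields.YangMills.BalabanUVNodes.N13UVChiOffSolvableAtRecord13 (histTerm_nonneg)

/-! ## §1. GENERIC OVER THE REPRESENTED TOWER OF RECORD: monotonicity of the transport, the base at level 0, and THE PIECE TOWER -/

section Tower

variable (F : T4Family) (N : ℕ) [NeZero N] (ν : Stage7Numerics) (τ : TowerNumerics)
variable (E : B12.RunParams → ℝ) (w : StepWeightsOfRecord F N ν τ.M) (ppSel : PpSelOfRecord F ν τ.M) (p : B12.RunParams) (g : ℕ → ℝ)

/-- **MONOTONICITY OF THE TRANSPORT OF RECORD** [folklore]: `0 ≤ f ≤ g` pointwise with `g` bounded measurable ⟹ `T_k f ≤ T_k g` pointwise (`|T f| ≤ T g` from S1's domination lemma;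
no measurability of `f` needed). [cite: Balaban1988Convergent, (3.1) p.264 (bookkeeping: the δ-function integral read as the tree's disintegration kernel)] -/
theorem transportOfRecord_mono (K k : ℕ) {f h : GaugeField (F.P K) k (SU N) → ℝ} (hf0 : ∀ U, 0 ≤ f U) (hle : ∀ U, f U ≤ h U)
    (hhm : Measurable h) {C : ℝ} (hhC : ∀ U, h U ≤ C) (V' : GaugeField (F.P K) (k + 1) (SU N)) :
    transportOfRecord F N K k f V' ≤ transportOfRecord F N K k h V' :=
  (le_abs_self _).trans
    (abs_transportOfRecord_le F N K k (fun U => by rw [abs_of_nonneg (hf0 U)]; exact hle U) hhm hhC V')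

open Classical in
/-- **THE PIECES ARE NON-NEGATIVE** when the history terms are ((r1); at the record: the ζ-laws, `histTerm_nonneg`). [cite: Balaban1989LargeFieldI, (0.2) p.176 (bookkeeping)] -/
theorem pieceOfRecord_nonneg (k : ℕ)
    (hpos : ∀ (s : SeqOfRecord F ν τ.M g p.K k) U, 0 ≤ chiSeqOfRecord F N ν τ.M g p.K k s U * slotsOfRecord F N ν τ E w ppSel p g k s U)
    (Z : Set (Site (F.P p.K) 0)) (U : GaugeField (F.P p.K) k (SU N)) :
    0 ≤ pieceOfRecord F N ν τ.M (slotsOfRecord F N ν τ E w ppSel) p g k Z U := by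
  unfold pieceOfRecord
  exact Finset.sum_nonneg fun s _ => hpos s U

/-- **THE LEVEL-0 HISTORY TERM IS THE START `ρ₀`**: `χ_0 ≡ 1` (def-T `chiSeqOfRecord_zero`) and `slot_0 = rhoZeroOfRecord` (`texpAOfRecord_zero`, `rfl`).
[cite: Balaban1988Convergent, Thm 1 p.262, (2.18) p.257 (bookkeeping)] -/
theorem histTerm_zero_eq (s : SeqOfRecord F ν τ.M g p.K 0) (U : GaugeField (F.P p.K) 0 (SU N)) :
    chiSeqOfRecord F N ν τ.M g p.K 0 s U * slotsOfRecord F N ν τ E w ppSel p g 0 s U = rhoZeroOfRecord F N p.K (g 0) (E p) U := by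
  rw [chiSeqOfRecord_zero, one_mul]
  rfl

open Classical in
/-- **★ THE BASE OF THE PIECE TOWER**: at level 0 the only admissible sequence is the empty one (`Seq.sum_seq_zero`) and its `Λ_0` is off-window (`= ∅`), so the only last region is `∅ᶜ`
and the piece there is the start: `ρ_0(Z, U) = [∅ᶜ = Z]·ρ₀(U)`. [cite: Balaban1989LargeFieldI, (0.2) p.176; Balaban1988Convergent, Thm 1 p.262 (bookkeeping)] -/
theorem pieceOfRecord_zero_eq (Z : Set (Site (F.P p.K) 0)) (U : GaugeField (F.P p.K) 0 (SU N)) :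
    pieceOfRecord F N ν τ.M (slotsOfRecord F N ν τ E w ppSel) p g 0 Z U
      = if (∅ : Set (Site (F.P p.K) 0))ᶜ = Z then rhoZeroOfRecord F N p.K (g 0) (E p) U else 0 := by
  unfold pieceOfRecord
  rw [Finset.sum_filter, Seq.sum_seq_zero, Seq.Λ_off _ 0 (by omega), histTerm_zero_eq]

open Classical in
/-- **THE BASE, BOUNDED**: `ρ_0(Z, U) ≤ [∅ᶜ = Z]·e^{−E}` — the Wilson–Boltzmann weight is `≤ 1` (`rhoZeroOfRecord_le`); this is where print's level-0 large-plaquette suppression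
`e^{−p₀(g₀)}` would sharpen the letter ([IV] (0.1) p.175; not used here). [cite: Balaban1988Convergent, Thm 1 p.262; Balaban1989LargeFieldI, (0.1) p.175, (0.2) p.176 (bookkeeping)] -/
theorem pieceOfRecord_zero_le (Z : Set (Site (F.P p.K) 0)) (U : GaugeField (F.P p.K) 0 (SU N)) :
    pieceOfRecord F N ν τ.M (slotsOfRecord F N ν τ E w ppSel) p g 0 Z U
      ≤ if (∅ : Set (Site (F.P p.K) 0))ᶜ = Z then Real.exp (-E p) else 0 := by
  rw [pieceOfRecord_zero_eq]
  split_ifs with hZ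
  · exact rhoZeroOfRecord_le F N p.K (g 0) (E p) U
  · exact le_rfl

open Classical in
/-- **★★★ THE (0.2) PIECE TOWER** ([IV] (0.4) by induction on the level, kernel form) [PROVED bookkeeping]: a family of field-dependent per-last-region majorants `m_j(Z)(U)` (measurable,
bounded) with the BASE `ρ_0(Z,·) ≤ m_0(Z)` and, for every `j < k`, the rows (r1) `hist_j ≥ 0`, (r2) `hist_j` measurable, (r3) `|w_j(s.snoc e)| ≤ W_j(Λ_j(s)ᶜ,e)` (`0 ≤ W_j ≤ 1` measurable),
(r4) `χ_{j+1}(s.snoc e) ≤ X_j(e)` (`X_j ≥ 0`), (r5) `|slot_{j+1}| ≤ c_R·|slotT_{j+1}|` with `0 ≤ c_R(s.snoc e) ≤ C_j(Λ_j(s)ᶜ,e)` (`C_j ≥ 0`), and the STEP ROW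
«`Σ_Z Σ_{q : q.1, q.2 ∈ 𝐃_{j+1}, q.2 ⊆ q.1, (1 ≤ j → q.1 ⊆ Zᶜ), q.2ᶜ = Z′} X_j(q)(V′)·C_j(Z,q)(V′)·T_j(W_j(Z,q)(·,V′)·m_j(Z))(V′) ≤ m_{j+1}(Z′)(V′)`» bounds every level-`k` piece:
`ρ_k(Z, V) ≤ m_k(Z)(V)` — p611473's piece-to-piece step at each level, the old pieces replaced by their majorants under `T_j` (`transportOfRecord_mono`).  The step rows and (r3)(r5) are the
DISPLAYED analytic ∕ structural content of one renormalization step ([III] §3 ∕ (2.49), [IV] §1 (0.3), [B16] (1.89)) — LOCATED, nobody's theorem here; nothing of Bałaban's asserted.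
[cite: Balaban1989LargeFieldI, (0.2)–(0.4) p.176; Balaban1988Convergent, (2.18) p.257, (2.49) p.264, (3.1) p.264, §3 p.267, (3.25) p.270; Balaban1989LargeFieldII, (1.89) p.387] -/
theorem pieceOfRecord_le_of_pieceTower (k : ℕ)
    (m : (j : ℕ) → Set (Site (F.P p.K) 0) → GaugeField (F.P p.K) j (SU N) → ℝ)
    (W : (j : ℕ) → Set (Site (F.P p.K) 0) → Set (Site (F.P p.K) 0) × Set (Site (F.P p.K) 0) →
      GaugeField (F.P p.K) j (SU N) → GaugeField (F.P p.K) (j + 1) (SU N) → ℝ)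
    (X : (j : ℕ) → Set (Site (F.P p.K) 0) × Set (Site (F.P p.K) 0) → GaugeField (F.P p.K) (j + 1) (SU N) → ℝ)
    (C : (j : ℕ) → Set (Site (F.P p.K) 0) → Set (Site (F.P p.K) 0) × Set (Site (F.P p.K) 0) → GaugeField (F.P p.K) (j + 1) (SU N) → ℝ)
    (cR : (j : ℕ) → SeqOfRecord F ν τ.M g p.K j → GaugeField (F.P p.K) j (SU N) → ℝ)
    (hpos : ∀ j, j < k → ∀ (s : SeqOfRecord F ν τ.M g p.K j) U,
      0 ≤ chiSeqOfRecord F N ν τ.M g p.K j s U * slotsOfRecord F N ν τ E w ppSel p g j s U)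
    (hmeas : ∀ j, j < k → ∀ s : SeqOfRecord F ν τ.M g p.K j,
      Measurable fun U => chiSeqOfRecord F N ν τ.M g p.K j s U * slotsOfRecord F N ν τ E w ppSel p g j s U)
    (hmm : ∀ j, j < k → ∀ Z, Measurable (m j Z)) (hmC : ∀ j, j < k → ∀ Z, ∃ CZ : ℝ, ∀ U, m j Z U ≤ CZ)
    (hWm : ∀ j, j < k → ∀ Z q V', Measurable fun U => W j Z q U V')
    (hW0 : ∀ j, j < k → ∀ Z q U V', 0 ≤ W j Z q U V') (hW1 : ∀ j, j < k → ∀ Z q U V', W j Z q U V' ≤ 1)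
    (hW : ∀ j, j < k → ∀ (s : SeqOfRecord F ν τ.M g p.K j) (e : Seq.ExtPair (DOfRecord F ν τ.M g p.K) j s) U V',
      |w p g j (s.snoc e) U V'| ≤ W j ((s.Λ j)ᶜ) e.1 U V')
    (hX0 : ∀ j, j < k → ∀ q V', 0 ≤ X j q V')
    (hX : ∀ j, j < k → ∀ (s : SeqOfRecord F ν τ.M g p.K j) (e : Seq.ExtPair (DOfRecord F ν τ.M g p.K) j s) V',
      chiSeqOfRecord F N ν τ.M g p.K (j + 1) (s.snoc e) V' ≤ X j e.1 V')
    (hcR : ∀ j, j < k → ∀ (s' : SeqOfRecord F ν τ.M g p.K (j + 1)) V', 0 ≤ cR (j + 1) s' V')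
    (hR : ∀ j, j < k → ∀ (s' : SeqOfRecord F ν τ.M g p.K (j + 1)) V',
      |slotsOfRecord F N ν τ E w ppSel p g (j + 1) s' V'| ≤ cR (j + 1) s' V' * |slotsTOfRecord F N ν τ E w ppSel p g (j + 1) s' V'|)
    (hC0 : ∀ j, j < k → ∀ Z q V', 0 ≤ C j Z q V')
    (hC : ∀ j, j < k → ∀ (s : SeqOfRecord F ν τ.M g p.K j) (e : Seq.ExtPair (DOfRecord F ν τ.M g p.K) j s) V',
      cR (j + 1) (s.snoc e) V' ≤ C j ((s.Λ j)ᶜ) e.1 V')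
    (h0 : ∀ Z U, pieceOfRecord F N ν τ.M (slotsOfRecord F N ν τ E w ppSel) p g 0 Z U ≤ m 0 Z U)
    (hstep : ∀ j, j < k → ∀ (Z' : Set (Site (F.P p.K) 0)) (V' : GaugeField (F.P p.K) (j + 1) (SU N)),
      ∑ Z : Set (Site (F.P p.K) 0), ∑ q ∈ Finset.univ.filter (fun q : Set (Site (F.P p.K) 0) × Set (Site (F.P p.K) 0) =>
            (q.1 ∈ DOfRecord F ν τ.M g p.K (j + 1) ∧ q.2 ∈ DOfRecord F ν τ.M g p.K (j + 1) ∧ q.2 ⊆ q.1 ∧ (1 ≤ j → q.1 ⊆ Zᶜ)) ∧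
              (q.2)ᶜ = Z'),
          X j q V' * C j Z q V' * transportOfRecord F N p.K j (fun U => W j Z q U V' * m j Z U) V' ≤ m (j + 1) Z' V') :
    ∀ (Z : Set (Site (F.P p.K) 0)) (V : GaugeField (F.P p.K) k (SU N)),
      pieceOfRecord F N ν τ.M (slotsOfRecord F N ν τ E w ppSel) p g k Z V ≤ m k Z V := by
  induction k with
  | zero => exact h0
  | succ k ih =>
    intro Z' V'
    have ih' := ih (fun j hj => hpos j (by omega)) (fun j hj => hmeas j (by omega)) (fun j hj => hmm j (by omega))
      (fun j hj => hmC j (by omega)) (fun j hj => hWm j (by omega)) (fun j hj => hW0 j (by omega)) (fun j hj => hW1 j (by omega))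
      (fun j hj => hW j (by omega)) (fun j hj => hX0 j (by omega)) (fun j hj => hX j (by omega)) (fun j hj => hcR j (by omega))
      (fun j hj => hR j (by omega)) (fun j hj => hC0 j (by omega)) (fun j hj => hC j (by omega)) (fun j hj => hstep j (by omega))
    have hk : k < k + 1 := lt_add_one k
    -- the level-`k` pieces are bounded (by their majorants)
    have hbdd : ∀ Z : Set (Site (F.P p.K) 0), ∃ CZ : ℝ, ∀ U,
        pieceOfRecord F N ν τ.M (slotsOfRecord F N ν τ E w ppSel) p g k Z U ≤ CZ := fun Z => by
      obtain ⟨CZ, hCZ⟩ := hmC k hk Z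
      exact ⟨CZ, fun U => (ih' Z U).trans (hCZ U)⟩
    -- p611473's piece-to-piece step at level `k`, then the old pieces replaced by `m_k` under `T_k`, then the step row
    refine (le_abs_self _).trans ((abs_pieceOfRecord_succ_le_sum_lastRegion_transport_piece F N ν τ E w ppSel p g k Z' V'
      (hpos k hk) (hmeas k hk) hbdd (W k) (fun Z q => hWm k hk Z q V') (fun Z q U => hW0 k hk Z q U V') (fun Z q U => hW1 k hk Z q U V')
      (fun s e U => hW k hk s e U V') (X k) (fun s e => hX k hk s e V') (cR (k + 1)) (fun s' => hcR k hk s' V') (fun s' => hR k hk s' V')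
      (C k) (fun s e => hC k hk s e V')).trans ((Finset.sum_le_sum fun Z _ => Finset.sum_le_sum fun q _ => ?_).trans (hstep k hk Z' V')))
    obtain ⟨CZ, hCZ⟩ := hmC k hk Z
    have hρ0 : ∀ U, 0 ≤ pieceOfRecord F N ν τ.M (slotsOfRecord F N ν τ E w ppSel) p g k Z U :=
      pieceOfRecord_nonneg F N ν τ E w ppSel p g k (hpos k hk) Z
    refine mul_le_mul_of_nonneg_left ?_ (mul_nonneg (hX0 k hk q V') (hC0 k hk Z q V'))
    refine transportOfRecord_mono F N p.K k (fun U => mul_nonneg (hW0 k hk Z q U V') (hρ0 U))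
      (fun U => mul_le_mul_of_nonneg_left (ih' Z U) (hW0 k hk Z q U V')) ((hWm k hk Z q V').mul (hmm k hk Z)) (C := 1 * CZ)
      (fun U => ?_) V'
    exact mul_le_mul (hW1 k hk Z q U V') (hCZ U) ((hρ0 U).trans (ih' Z U)) zero_le_one

end Tower

/-! ## §2. AT K1⁷'s RECORD: the base and the piece tower with (r1) discharged by the ζ-laws of `Provisos₁₃CoPH` -/

section AtRecord

variable (F : T4Family) (N : ℕ) [NeZero N]
variable (θ : Stage13HParams F N) (P : B12.RunParams)

open Classical in
/-- **THE BASE AT THE RECORD**: `ρ_0(Z, U) ≤ [∅ᶜ = Z]·e^{−E(P)}` for the pieces of `densOfRecord₁₃` along the run `P` (`E := EOfRecord₁₃`). [cite: Balaban1988Convergent, Thm 1 p.262; Balaban1989LargeFieldI, (0.2) p.176 (bookkeeping)] -/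
theorem pieceOfRecord₁₃_zero_le (Z : Set (Site (F.P P.K) 0)) (U : GaugeField (F.P P.K) 0 (SU N)) :
    pieceOfRecord F N θ.ν θ.τ9.M
        (slotsOfRecord F N θ.ν θ.τ9 (EOfRecord₁₃ F N θ.toStage13Params) (wOfRecord₉ F N θ.toStage9Params) θ.ppSel)
        P (gOfRecord₁₃ F N θ.toStage13Params P) 0 Z U
      ≤ if (∅ : Set (Site (F.P P.K) 0))ᶜ = Z then Real.exp (-EOfRecord₁₃ F N θ.toStage13Params P) else 0 :=
  pieceOfRecord_zero_le F N θ.ν θ.τ9 (EOfRecord₁₃ F N θ.toStage13Params) (wOfRecord₉ F N θ.toStage9Params) θ.ppSel P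
    (gOfRecord₁₃ F N θ.toStage13Params P) Z U

open Classical in
/-- **★★★ THE (0.2) PIECE TOWER AT K1⁷'s RECORD** (ν := θ.ν, τ := θ.τ9, E := `EOfRecord₁₃`, w := `wOfRecord₉`, ppSel := θ.ppSel, g := `gOfRecord₁₃`): with (r1) DISCHARGED at every level by
dag-n13-w1's `histTerm_nonneg` (`h.zetaUnity`, `h.zetaAbs`), per-last-region majorants `m_j(Z)` with the base, the displayed rows (r2)–(r5), and the step rows bound every level-`k` piece of
`densOfRecord₁₃` along the run `P`: `ρ_k(Z, V) ≤ m_k(Z)(V)`.  CONDITIONAL on the displayed rows; nothing of Bałaban's asserted; (U1) NOT proved.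
[cite: Balaban1989LargeFieldI, (0.2)–(0.4) p.176; Balaban1988Convergent, (2.18) p.257, (2.49) p.264, (3.1) p.264, §3 p.267, (3.25) p.270; Balaban1989LargeFieldII, (1.89) p.387] -/
theorem pieceOfRecord₁₃_le_of_pieceTower (h : θ.Provisos₁₃CoPH F N) (k : ℕ)
    (m : (j : ℕ) → Set (Site (F.P P.K) 0) → GaugeField (F.P P.K) j (SU N) → ℝ)
    (W : (j : ℕ) → Set (Site (F.P P.K) 0) → Set (Site (F.P P.K) 0) × Set (Site (F.P P.K) 0) →
      GaugeField (F.P P.K) j (SU N) → GaugeField (F.P P.K) (j + 1) (SU N) → ℝ)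
    (X : (j : ℕ) → Set (Site (F.P P.K) 0) × Set (Site (F.P P.K) 0) → GaugeField (F.P P.K) (j + 1) (SU N) → ℝ)
    (C : (j : ℕ) → Set (Site (F.P P.K) 0) → Set (Site (F.P P.K) 0) × Set (Site (F.P P.K) 0) → GaugeField (F.P P.K) (j + 1) (SU N) → ℝ)
    (cR : (j : ℕ) → SeqOfRecord F θ.ν θ.τ9.M (gOfRecord₁₃ F N θ.toStage13Params P) P.K j → GaugeField (F.P P.K) j (SU N) → ℝ)
    (hmeas : ∀ j, j < k → ∀ s : SeqOfRecord F θ.ν θ.τ9.M (gOfRecord₁₃ F N θ.toStage13Params P) P.K j,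
      Measurable fun U => chiSeqOfRecord F N θ.ν θ.τ9.M (gOfRecord₁₃ F N θ.toStage13Params P) P.K j s U *
        slotsOfRecord F N θ.ν θ.τ9 (EOfRecord₁₃ F N θ.toStage13Params) (wOfRecord₉ F N θ.toStage9Params) θ.ppSel P
          (gOfRecord₁₃ F N θ.toStage13Params P) j s U)
    (hmm : ∀ j, j < k → ∀ Z, Measurable (m j Z)) (hmC : ∀ j, j < k → ∀ Z, ∃ CZ : ℝ, ∀ U, m j Z U ≤ CZ)
    (hWm : ∀ j, j < k → ∀ Z q V', Measurable fun U => W j Z q U V')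
    (hW0 : ∀ j, j < k → ∀ Z q U V', 0 ≤ W j Z q U V') (hW1 : ∀ j, j < k → ∀ Z q U V', W j Z q U V' ≤ 1)
    (hW : ∀ j, j < k → ∀ (s : SeqOfRecord F θ.ν θ.τ9.M (gOfRecord₁₃ F N θ.toStage13Params P) P.K j)
        (e : Seq.ExtPair (DOfRecord F θ.ν θ.τ9.M (gOfRecord₁₃ F N θ.toStage13Params P) P.K) j s) U V',
      |wOfRecord₉ F N θ.toStage9Params P (gOfRecord₁₃ F N θ.toStage13Params P) j (s.snoc e) U V'| ≤ W j ((s.Λ j)ᶜ) e.1 U V')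
    (hX0 : ∀ j, j < k → ∀ q V', 0 ≤ X j q V')
    (hX : ∀ j, j < k → ∀ (s : SeqOfRecord F θ.ν θ.τ9.M (gOfRecord₁₃ F N θ.toStage13Params P) P.K j)
        (e : Seq.ExtPair (DOfRecord F θ.ν θ.τ9.M (gOfRecord₁₃ F N θ.toStage13Params P) P.K) j s) V',
      chiSeqOfRecord F N θ.ν θ.τ9.M (gOfRecord₁₃ F N θ.toStage13Params P) P.K (j + 1) (s.snoc e) V' ≤ X j e.1 V')
    (hcR : ∀ j, j < k → ∀ (s' : SeqOfRecord F θ.ν θ.τ9.M (gOfRecord₁₃ F N θ.toStage13Params P) P.K (j + 1)) V', 0 ≤ cR (j + 1) s' V')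
    (hR : ∀ j, j < k → ∀ (s' : SeqOfRecord F θ.ν θ.τ9.M (gOfRecord₁₃ F N θ.toStage13Params P) P.K (j + 1)) V',
      |slotsOfRecord F N θ.ν θ.τ9 (EOfRecord₁₃ F N θ.toStage13Params) (wOfRecord₉ F N θ.toStage9Params) θ.ppSel P
          (gOfRecord₁₃ F N θ.toStage13Params P) (j + 1) s' V'| ≤
        cR (j + 1) s' V' * |slotsTOfRecord F N θ.ν θ.τ9 (EOfRecord₁₃ F N θ.toStage13Params) (wOfRecord₉ F N θ.toStage9Params) θ.ppSel P
          (gOfRecord₁₃ F N θ.toStage13Params P) (j + 1) s' V'|)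
    (hC0 : ∀ j, j < k → ∀ Z q V', 0 ≤ C j Z q V')
    (hC : ∀ j, j < k → ∀ (s : SeqOfRecord F θ.ν θ.τ9.M (gOfRecord₁₃ F N θ.toStage13Params P) P.K j)
        (e : Seq.ExtPair (DOfRecord F θ.ν θ.τ9.M (gOfRecord₁₃ F N θ.toStage13Params P) P.K) j s) V',
      cR (j + 1) (s.snoc e) V' ≤ C j ((s.Λ j)ᶜ) e.1 V')
    (h0 : ∀ Z U, pieceOfRecord F N θ.ν θ.τ9.M
        (slotsOfRecord F N θ.ν θ.τ9 (EOfRecord₁₃ F N θ.toStage13Params) (wOfRecord₉ F N θ.toStage9Params) θ.ppSel)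
        P (gOfRecord₁₃ F N θ.toStage13Params P) 0 Z U ≤ m 0 Z U)
    (hstep : ∀ j, j < k → ∀ (Z' : Set (Site (F.P P.K) 0)) (V' : GaugeField (F.P P.K) (j + 1) (SU N)),
      ∑ Z : Set (Site (F.P P.K) 0), ∑ q ∈ Finset.univ.filter (fun q : Set (Site (F.P P.K) 0) × Set (Site (F.P P.K) 0) =>
            (q.1 ∈ DOfRecord F θ.ν θ.τ9.M (gOfRecord₁₃ F N θ.toStage13Params P) P.K (j + 1) ∧
              q.2 ∈ DOfRecord F θ.ν θ.τ9.M (gOfRecord₁₃ F N θ.toStage13Params P) P.K (j + 1) ∧ q.2 ⊆ q.1 ∧ (1 ≤ j → q.1 ⊆ Zᶜ)) ∧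
              (q.2)ᶜ = Z'),
          X j q V' * C j Z q V' * transportOfRecord F N P.K j (fun U => W j Z q U V' * m j Z U) V' ≤ m (j + 1) Z' V') :
    ∀ (Z : Set (Site (F.P P.K) 0)) (V : GaugeField (F.P P.K) k (SU N)),
      pieceOfRecord F N θ.ν θ.τ9.M
          (slotsOfRecord F N θ.ν θ.τ9 (EOfRecord₁₃ F N θ.toStage13Params) (wOfRecord₉ F N θ.toStage9Params) θ.ppSel)
          P (gOfRecord₁₃ F N θ.toStage13Params P) k Z V ≤ m k Z V :=
  pieceOfRecord_le_of_pieceTower F N θ.ν θ.τ9 (EOfRecord₁₃ F N θ.toStage13Params) (wOfRecord₉ F N θ.toStage9Params) θ.ppSel P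
    (gOfRecord₁₃ F N θ.toStage13Params P) k m W X C cR
    (fun j _ s U => histTerm_nonneg θ.toStage13Params h.zetaUnity h.zetaAbs P j s U)
    hmeas hmm hmC hWm hW0 hW1 hW hX0 hX hcR hR hC0 hC h0 hstep

end AtRecord

end Summit.QuantumFields.YangMills.BalabanUVNodes.N13U1PieceTowerAtRecord13CoPH

end
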